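import Summits.ABC.IUTFork.Cor312PilotIdelesMRead
import HarnessLib

/-!
# [IUTchIII] Corollary 3.12, statement — the pilot ideles at the M-level presentation are units of norm `1` OFF THE
# SUPPORT PRIMES `T(I)` (G1-Θ unit P4a, fifth file: the idele-side input of hypothesis (hlow) of abc-iut-w5-d166's
# assembly `negLogTheta_le_genuine_of_local_bounds`, p438195, which is stated on `ratChar u ∉ (volumeInputOf D r).supportPrimes`)

Record-only file (D-0012) of the abc-iut cell (seat abc-iut-w5-d033, gen 9; branch C «abc ⇐ S», C-R12 (e) target #2′).
TAKES NO SIDE on [IUTchIII] Cor. 3.12. PROOF-ONLY sequel of `Cor312PilotIdelesMRead` (p436273). abc-iut-S2's support set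
`I.supportPrimes ⊇ {p_v : v ∈ V^bad_mod}` ([IUTchIV] Thm. 1.10 Step (vi); `residueChar_mem_supportPrimes`); at a prime
`p ∉ T(I)` NO place of `F_mod` over `p` is bad, so at EVERY member `x` of the fibre of `V̲ → V_ℚ` over the place `u ∋ p`
the genuine Θ- and `q`-ideles are units of norm `1`:

* `residueChar_placeModOfM` (`p_{v(x)} = p`), `placeModOfM_not_mem_S_of_not_mem_supportPrimes`;
* **`norm_tThetaM_eq_one_of_not_mem_supportPrimes`**, **`norm_tqM_eq_one_of_not_mem_supportPrimes`** (and the `log = 0`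
  forms) — for idele data `r` (support of `volumeInputOf D r`) and on a volume input `I` (`…_ideleDataOf…`, support of `I`).

[cite: Mochizuki2012, IUTchIV Thm. 1.10 Step (vi) p. 29] [cite: DupuyHilado2025, §3.3, §3.4, §3.9]
[claim: Mochizuki2012, status: disputed] for the quoted setting. HONEST FRAMING: bookkeeping over OUR typed objects;
nothing here bears on the truth of [IUTchIII] Cor. 3.12; typed ≠ proved; instantiated ≠ endorsed.
-/

noncomputable section

open Set Function NumberField IsDedekindDomain
open scoped Pointwise

namespace Summit.ABC.IUTFork.Thm311.Real

open Cor312Vol Literature.IUT.LogThetaLattice Literature.IUT.LogVolume Literature.IUT.HodgeTheaters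
  Literature.NumberTheory.NumberFields

variable {F K Fbar : Type} [Field F] [NumberField F] [Field K] [NumberField K] [Algebra F K]
  [Field Fbar] [Algebra F Fbar] [Algebra K Fbar] {E : WeierstrassCurve F} [E.IsElliptic] {l : ℕ}
  {Pb : BadPlacePredicates K} (D : InitialThetaData F K Fbar E l Pb)
  (p : ℕ) [hp : Fact p.Prime] (u : FinitePlace ℚ) (hu : ((p : ℕ) : 𝓞 ℚ) ∈ (FinitePlace.maximalIdeal u).asIdeal)

include hu in
/-- **`p_{v(x)} = p`**: the residue characteristic of the place of `F_mod` under a member of the fibre over `u ∋ p` is `p`.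
[folklore] -/
theorem residueChar_placeModOfM (x : (thetaIndexOfInitial D).Fibre (Val.non u)) :
    residueChar (fieldOfModuli E) (placeModOfM D u x) = p :=
  residueChar_eq_of_natCast_mem p (natCast_mem_of_mem_placesOver (E := E) p (placeOverOfFibreM D p u hu x))

section Ideles

variable (r : ThetaData.IdeleData D)

include hu in
/-- At a prime `p` outside the support `T(I)` of the volume input `volumeInputOf D r`, no place of `F_mod` under a member
of the fibre over `u ∋ p` is bad (`{p_v : v ∈ V^bad_mod} ⊆ T(I)`). [cite: Mochizuki2012, IUTchIV Thm. 1.10 Step (vi) p. 29] -/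
theorem placeModOfM_not_mem_S_of_not_mem_supportPrimes (x : (thetaIndexOfInitial D).Fibre (Val.non u))
    (hT : p ∉ (ThetaData.volumeInputOf D r).supportPrimes) : placeModOfM D u x ∉ (ThetaData.pilotData D).S := by
  intro hx
  apply hT
  have h := (ThetaData.volumeInputOf D r).residueChar_mem_supportPrimes (v := placeModOfM D u x) hx
  rwa [residueChar_placeModOfM D p u hu x] at h

include hu in
/-- **The Θ-idele is a unit of norm `1` off `T(I)`** (idele side of hypothesis (hlow) of abc-iut-w5-d166's
`negLogTheta_le_genuine_of_local_bounds`): for `p ∉ (volumeInputOf D r).supportPrimes`, `‖tThetaM D p u hu r i x‖ = 1` at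
every member `x` of the fibre over `u ∋ p`, in every degree. [cite: DupuyHilado2025, §3.3, §3.4] -/
theorem norm_tThetaM_eq_one_of_not_mem_supportPrimes (i : Fin (thetaIndexOfInitial D).lstar)
    (x : (thetaIndexOfInitial D).Fibre (Val.non u)) (hT : p ∉ (ThetaData.volumeInputOf D r).supportPrimes) :
    ‖tThetaM D p u hu r i x‖ = 1 :=
  norm_tThetaM_eq_one_of_not_mem D p u hu r i x (placeModOfM_not_mem_S_of_not_mem_supportPrimes D p u hu r x hT)

include hu in
/-- **The `q`-idele is a unit of norm `1` off `T(I)`.** [cite: DupuyHilado2025, §3.3, §3.4] -/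
theorem norm_tqM_eq_one_of_not_mem_supportPrimes (x : (thetaIndexOfInitial D).Fibre (Val.non u))
    (hT : p ∉ (ThetaData.volumeInputOf D r).supportPrimes) : ‖tqM D p u hu r x‖ = 1 :=
  norm_tqM_eq_one_of_not_mem D p u hu r x (placeModOfM_not_mem_S_of_not_mem_supportPrimes D p u hu r x hT)

include hu in
/-- … hence `log ‖t_Θ‖ = 0` off `T(I)`. [cite: DupuyHilado2025, §3.4] -/
theorem log_norm_tThetaM_eq_zero_of_not_mem_supportPrimes (i : Fin (thetaIndexOfInitial D).lstar)
    (x : (thetaIndexOfInitial D).Fibre (Val.non u)) (hT : p ∉ (ThetaData.volumeInputOf D r).supportPrimes) :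
    Real.log ‖tThetaM D p u hu r i x‖ = 0 := by
  rw [norm_tThetaM_eq_one_of_not_mem_supportPrimes D p u hu r i x hT, Real.log_one]

include hu in
/-- … and `log ‖t_q‖ = 0` off `T(I)`. [cite: DupuyHilado2025, §3.4] -/
theorem log_norm_tqM_eq_zero_of_not_mem_supportPrimes (x : (thetaIndexOfInitial D).Fibre (Val.non u))
    (hT : p ∉ (ThetaData.volumeInputOf D r).supportPrimes) : Real.log ‖tqM D p u hu r x‖ = 0 := by
  rw [norm_tqM_eq_one_of_not_mem_supportPrimes D p u hu r x hT, Real.log_one]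

end Ideles

include hu in
/-- The Θ-idele of a volume input `I` of `D` is a unit of norm `1` off `T(I)` (support read on `I` itself).
[cite: DupuyHilado2025, §3.3, §3.4] -/
theorem norm_tThetaM_ideleDataOf_eq_one_of_not_mem_supportPrimes {I : ThetaVolumeInput (fieldOfModuli E) K}
    (hI : ThetaData.IsVolumeInputOf D I) (i : Fin (thetaIndexOfInitial D).lstar)
    (x : (thetaIndexOfInitial D).Fibre (Val.non u)) (hT : p ∉ I.supportPrimes) :
    ‖tThetaM D p u hu (ideleDataOf D hI) i x‖ = 1 := by
  refine norm_tThetaM_eq_one_of_not_mem_supportPrimes D p u hu _ i x ?_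
  rwa [← eq_volumeInputOf_ideleDataOf D hI]

include hu in
/-- The `q`-idele of a volume input `I` of `D` is a unit of norm `1` off `T(I)`. [cite: DupuyHilado2025, §3.3, §3.4] -/
theorem norm_tqM_ideleDataOf_eq_one_of_not_mem_supportPrimes {I : ThetaVolumeInput (fieldOfModuli E) K}
    (hI : ThetaData.IsVolumeInputOf D I) (x : (thetaIndexOfInitial D).Fibre (Val.non u)) (hT : p ∉ I.supportPrimes) :
    ‖tqM D p u hu (ideleDataOf D hI) x‖ = 1 := by
  refine norm_tqM_eq_one_of_not_mem_supportPrimes D p u hu _ x ?_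
  rwa [← eq_volumeInputOf_ideleDataOf D hI]

end Summit.ABC.IUTFork.Thm311.Real

end
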